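import Literature.Geometry.Kaehler.AnalyticSetRegular

/-!
# Stub `stub_graphAnalytic` (G2c; line `purity-sorted-hecke-envelope` / `HeckeGraphChow` of crux
# `EndoscopicMiddleDegree.OrthogonalEnveloped`, stmt-HodgeConjecture-14300): the graph of a
# holomorphic map is an analytic subset, regular of codimension `dim(target)` at each of its points

Registered skeleton: `HeckeGraphChow` of crux `OrthogonalEnveloped`; intended as the file
`Theorems/EndoscopicMiddleDegreeOrthogonalEnvelopedGraphAnalytic.lean` of the summit
(`--supports stmt-HodgeConjecture-14300`), the generic ingredient of the construction stub
`stub_heckeGraphAnalytic` (the Hecke graph is, locally, a finite union of graphs of local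
biholomorphisms of `X^an`).

WHAT IS PROVED. For complex normed spaces `E`, `F` (`F` finite-dimensional), a charted space `M`
over `E`, a complex-analytic manifold `N` over `F` (`IsManifold 𝓘(ℂ, F) 1 N` suffices) and a map
`f : M → N` which is complex-differentiable (`MDifferentiable 𝓘(ℂ, E) 𝓘(ℂ, F) f`), the graph
`Γ_f = {z : M × N | z.2 = f z.1}`, a subset of the charted space `M × N` (Mathlib's instance
`prodChartedSpace E M F N : ChartedSpace (ModelProd E F) (M × N)`, model `𝓘(ℂ, E).prod 𝓘(ℂ, F)`;
equivalently, after `letI : ChartedSpace (E × F) (M × N) := prodChartedSpace E M F N`, model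
`𝓘(ℂ, E × F)` — the two models agree by `modelWithCornersSelf_prod`), satisfies:

* `isRegularPointOfCodim_graph` — every point `z₀ ∈ Γ_f` is a regular point of `Γ_f` of
  codimension `finrank ℂ F` (`Literature.Geometry.Kaehler.IsRegularPointOfCodim`). Proof (Chirka
  §2.3; Griffiths–Harris Ch. 0 §2): let `ψ = extChartAt 𝓘(ℂ, F) z₀.2` be the chart of `N` at
  `z₀.2 = f z₀.1`, `L : F →L[ℂ] ℂᵖ` a linear isomorphism (`p = finrank ℂ F`) and `Ψ = L ∘ ψ`; on the
  open neighbourhood `U = {z | z.2 ∈ dom ψ ∧ f z.1 ∈ dom ψ}` of `z₀` the `p` functions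
  `g z = Ψ z.2 - Ψ (f z.1)` are holomorphic (chain rule `hasMFDerivAt_graphEquation`:
  `Dg(z) = DΨ(z.2) ∘ pr₂ - DΨ(f z.1) ∘ Df(z.1) ∘ pr₁`), cut out `Γ_f ∩ U` (`ψ` is injective on its
  source), and `Dg(z₀)` is onto: already `Dg(z₀)(0, u) = DΨ(z₀.2) u`, and `DΨ(z₀.2)` is onto since
  `Ψ` written in the chart `ψ` is the isomorphism `L` near `ψ z₀.2`
  (`Literature.Geometry.Kaehler.surjective_mfderiv_iff_extChartAt`).
* `isAnalyticSet_graph` — if moreover `N` is Hausdorff, `Γ_f` is an analytic subset of `M × N`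
  (`Literature.Geometry.Kaehler.IsAnalyticSet`): at its own points by the above, and off `Γ_f`
  vacuously since `Γ_f` is closed (`isClosed_eq`; `IsAnalyticSetAt.of_notMem_closure`).
* `stub_graphAnalytic_prod` / `stub_graphAnalytic` — the conjunction, in the binder layout of the
  registered stub, in the `.prod` spelling / in the registered `𝓘(ℂ, E × F)` spelling (with the
  `letI` above), both with the hypothesis `[T2Space N]` added to the registered signature. WITHOUT
  the `letI` the registered statement does not elaborate (no instance `ChartedSpace (E × F) (M × N)`
  is found: instance synthesis does not unfold `ModelProd`). The Hausdorff hypothesis is NECESSARY: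
  analytic subsets are closed (`IsAnalyticSet.isClosed`), and for `f = id : N → N` the graph is the
  diagonal, closed iff `N` is T₂ (`t2_iff_isClosed_diagonal`), while Mathlib manifolds — e.g. the
  complex line with two origins, an analytic `ChartedSpace ℂ` — need not be Hausdorff
  (`Mathlib/Geometry/Manifold/IsManifold/Basic.lean`: "Some texts assume manifolds to be Hausdorff
  … We (in mathlib) assume neither"); worker scratch `StubGraphAnalytic_t2check.lean` derives
  `T2Space N` for every analytic `N` from the un-corrected statement.

Sources: E. M. Chirka, *Complex Analytic Sets* (1989), §2.3 (regular points; graphs and level sets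
of holomorphic maps of maximal rank); P. Griffiths, J. Harris, *Principles of Algebraic Geometry*
(1978), Ch. 0 §2 (smooth points of analytic varieties, implicit function theorem).
-/

noncomputable section

-- The crux-workfile namespace `Summit.<P>.<Sub>.Cruxes.…` repeats `HodgeConjecture` (single-conjunct summit).
set_option linter.dupNamespace false

namespace Summit.HodgeConjecture.HodgeConjecture.Cruxes.OrthogonalEnveloped.HeckeGraphChow

open scoped Manifold ContDiff Topology
open Set Filter
open Literature.Geometry.Kaehler (IsAnalyticSet IsAnalyticSetAt regularLocus IsRegularPointOfCodim
  surjective_mfderiv_iff_extChartAt)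

section Graph

variable {E : Type*} [NormedAddCommGroup E] [NormedSpace ℂ E]
  {F : Type*} [NormedAddCommGroup F] [NormedSpace ℂ F]
  {G : Type*} [NormedAddCommGroup G] [NormedSpace ℂ G]
  {M : Type*} [TopologicalSpace M] [ChartedSpace E M]
  {N : Type*} [TopologicalSpace N] [ChartedSpace F N]

/-- **Chain rule for the local equations of a graph.** If `f : M → N` is complex-differentiable and
`Ψ : N → G` has derivative `A` at `z.2` and `B` at `f z.1`, then `w ↦ Ψ w.2 - Ψ (f w.1)` on `M × N`
has derivative `A ∘ pr₂ - B ∘ Df(z.1) ∘ pr₁` at `z` (Mathlib: `hasMFDerivAt_snd`, `hasMFDerivAt_fst`,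
`HasMFDerivAt.comp`, `HasMFDerivAt.sub`). [folklore] -/
theorem hasMFDerivAt_graphEquation {f : M → N} (hf : MDifferentiable 𝓘(ℂ, E) 𝓘(ℂ, F) f)
    {Ψ : N → G} {z : M × N} {A : TangentSpace 𝓘(ℂ, F) z.2 →L[ℂ] G}
    (hA : HasMFDerivAt 𝓘(ℂ, F) 𝓘(ℂ, G) Ψ z.2 A) {B : TangentSpace 𝓘(ℂ, F) (f z.1) →L[ℂ] G}
    (hB : HasMFDerivAt 𝓘(ℂ, F) 𝓘(ℂ, G) Ψ (f z.1) B) :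
    HasMFDerivAt (𝓘(ℂ, E).prod 𝓘(ℂ, F)) 𝓘(ℂ, G) (fun w : M × N => Ψ w.2 - Ψ (f w.1)) z
      (A.comp (ContinuousLinearMap.snd ℂ (TangentSpace 𝓘(ℂ, E) z.1) (TangentSpace 𝓘(ℂ, F) z.2)) -
        (B.comp (mfderiv 𝓘(ℂ, E) 𝓘(ℂ, F) f z.1)).comp
          (ContinuousLinearMap.fst ℂ (TangentSpace 𝓘(ℂ, E) z.1) (TangentSpace 𝓘(ℂ, F) z.2))) :=
  (hA.comp z (hasMFDerivAt_snd (I := 𝓘(ℂ, E)) (I' := 𝓘(ℂ, F)) z)).sub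
    ((hB.comp z.1 (hf z.1).hasMFDerivAt).comp z
      (hasMFDerivAt_fst (I := 𝓘(ℂ, E)) (I' := 𝓘(ℂ, F)) z))

-- Evaluating the differential of `hasMFDerivAt_graphEquation` on a tangent vector `(0, u)` uses the
-- definitional identifications `T_z (M × N) = T M × T N` and `T (ℂᵖ) = ℂᵖ` of Mathlib's `mfderiv`
-- calculus (cf. the `Arithmetic` section of `Mathlib/Geometry/Manifold/MFDeriv/SpecificFunctions`).
set_option backward.isDefEq.respectTransparency false in
/-- **Points of a graph are regular of codimension `dim N`.** For `f : M → N` complex-differentiable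
into an analytic manifold `N` modelled on `F` (finite-dimensional) and `z₀ = (x₀, f x₀)`, the graph
`{z | z.2 = f z.1} ⊆ M × N` is cut out, on the neighbourhood
`U = {z | z.2 ∈ dom ψ ∧ f z.1 ∈ dom ψ}` of `z₀` (`ψ` the chart of `N` at `f x₀`, `L : F ≃ ℂᵖ` linear),
by the `p = finrank ℂ F` holomorphic equations `L (ψ z.2) - L (ψ (f z.1)) = 0`, whose differential at
`z₀` is onto (its restriction to `0 × T N` is `L ∘ Dψ`). [cite: Chirka1989, §2.3]
[cite: GriffithsHarrisPrinciples1978, Ch. 0 §2] -/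
theorem isRegularPointOfCodim_graph [FiniteDimensional ℂ F] [IsManifold 𝓘(ℂ, F) 1 N] {f : M → N}
    (hf : MDifferentiable 𝓘(ℂ, E) 𝓘(ℂ, F) f) {z₀ : M × N} (hz₀ : z₀.2 = f z₀.1) :
    IsRegularPointOfCodim (𝓘(ℂ, E).prod 𝓘(ℂ, F)) {z : M × N | z.2 = f z.1}
      (Module.finrank ℂ F) z₀ := by
  -- linear coordinates `L : F ≃ ℂ^p` on `F`
  obtain ⟨L, hLi, hLs⟩ : ∃ L : F →L[ℂ] (Fin (Module.finrank ℂ F) → ℂ),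
      Function.Injective L ∧ Function.Surjective L := by
    set e : F ≃L[ℂ] (Fin (Module.finrank ℂ F) → ℂ) :=
      ContinuousLinearEquiv.ofFinrankEq (Module.finrank_fin_fun ℂ).symm
    refine ⟨(e : F →L[ℂ] (Fin (Module.finrank ℂ F) → ℂ)), ?_, ?_⟩
    · rw [ContinuousLinearEquiv.coe_coe]; exact e.injective
    · rw [ContinuousLinearEquiv.coe_coe]; exact e.surjective
  -- the chart `ψ` of `N` at `z₀.2 = f z₀.1`, read in these coordinates (`Ψ = L ∘ ψ`), is holomorphic
  -- on the chart domain
  have hΨ : ∀ y ∈ (chartAt F z₀.2).source, MDifferentiableAt 𝓘(ℂ, F)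
      𝓘(ℂ, Fin (Module.finrank ℂ F) → ℂ) (L ∘ extChartAt 𝓘(ℂ, F) z₀.2) y :=
    fun y hy => L.mdifferentiableAt.comp y (mdifferentiableAt_extChartAt hy)
  -- the neighbourhood `U = (M × chart domain) ∩ (f ∘ pr₁)⁻¹ (chart domain)` of `z₀`
  have hUo : IsOpen {z : M × N | z.2 ∈ (chartAt F z₀.2).source ∧ f z.1 ∈ (chartAt F z₀.2).source} :=
    ((chartAt F z₀.2).open_source.preimage continuous_snd).inter
      ((chartAt F z₀.2).open_source.preimage (hf.continuous.comp continuous_fst))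
  have hz₀U : z₀ ∈ {z : M × N | z.2 ∈ (chartAt F z₀.2).source ∧ f z.1 ∈ (chartAt F z₀.2).source} :=
    ⟨mem_chart_source F z₀.2, by rw [← hz₀]; exact mem_chart_source F z₀.2⟩
  refine ⟨_, hUo, hz₀U,
    fun w => (L ∘ extChartAt 𝓘(ℂ, F) z₀.2) w.2 - (L ∘ extChartAt 𝓘(ℂ, F) z₀.2) (f w.1),
    fun z hz => (hasMFDerivAt_graphEquation hf (hΨ _ hz.1).hasMFDerivAt
      (hΨ _ hz.2).hasMFDerivAt).mdifferentiableAt.mdifferentiableWithinAt, ?_, ?_⟩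
  · -- on `U` the graph is the zero set `{Ψ z.2 = Ψ (f z.1)}`: the chart is injective on its source
    ext z
    simp only [mem_inter_iff, mem_setOf_eq, mem_preimage, mem_singleton_iff, Function.comp_apply]
    constructor
    · rintro ⟨hz, hzU⟩
      exact ⟨hzU, by rw [hz, sub_self]⟩
    · rintro ⟨hzU, h0⟩
      refine ⟨(extChartAt 𝓘(ℂ, F) z₀.2).injOn ?_ ?_ (hLi (sub_eq_zero.1 h0)), hzU⟩
      · rw [extChartAt_source]; exact hzU.1
      · rw [extChartAt_source]; exact hzU.2
  · -- the differential at `z₀` is onto: on `0 × T N` it is `DΨ(z₀.2)`, and `Ψ` written in the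
    -- chart `ψ` is the linear isomorphism `L` near `ψ z₀.2`, so `DΨ(z₀.2)` is onto
    have hev : (L ∘ extChartAt 𝓘(ℂ, F) z₀.2) ∘ (extChartAt 𝓘(ℂ, F) z₀.2).symm
        =ᶠ[𝓝 (extChartAt 𝓘(ℂ, F) z₀.2 z₀.2)] L := by
      filter_upwards [extChartAt_target_mem_nhds (I := 𝓘(ℂ, F)) z₀.2] with e he
      simp only [Function.comp_apply, (extChartAt 𝓘(ℂ, F) z₀.2).right_inv he]
    have hL' := L.hasFDerivAt.congr_of_eventuallyEq hev
    have hΨs : Function.Surjective (mfderiv 𝓘(ℂ, F) 𝓘(ℂ, Fin (Module.finrank ℂ F) → ℂ)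
        (L ∘ extChartAt 𝓘(ℂ, F) z₀.2) z₀.2) := by
      refine (surjective_mfderiv_iff_extChartAt (mem_extChartAt_source z₀.2)
        hL'.differentiableAt).2 ?_
      rw [hL'.fderiv]
      exact hLs
    rw [(hasMFDerivAt_graphEquation hf (hΨ _ hz₀U.1).hasMFDerivAt
      (hΨ _ hz₀U.2).hasMFDerivAt).mfderiv]
    intro w
    obtain ⟨u, hu⟩ := hΨs w
    refine ⟨((0 : TangentSpace 𝓘(ℂ, E) z₀.1), u), ?_⟩
    have h0 : @Eq (Fin (Module.finrank ℂ F) → ℂ)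
        (mfderiv 𝓘(ℂ, F) 𝓘(ℂ, Fin (Module.finrank ℂ F) → ℂ) (L ∘ extChartAt 𝓘(ℂ, F) z₀.2)
          (f z₀.1) (mfderiv 𝓘(ℂ, E) 𝓘(ℂ, F) f z₀.1 0)) 0 := by
      rw [map_zero, map_zero]
    change @HSub.hSub (Fin (Module.finrank ℂ F) → ℂ) _ _ instHSub
      (mfderiv 𝓘(ℂ, F) 𝓘(ℂ, Fin (Module.finrank ℂ F) → ℂ) (L ∘ extChartAt 𝓘(ℂ, F) z₀.2) z₀.2 u)
      (mfderiv 𝓘(ℂ, F) 𝓘(ℂ, Fin (Module.finrank ℂ F) → ℂ) (L ∘ extChartAt 𝓘(ℂ, F) z₀.2)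
        (f z₀.1) (mfderiv 𝓘(ℂ, E) 𝓘(ℂ, F) f z₀.1 0)) = w
    rw [h0, hu, sub_zero]

omit [ChartedSpace E M] in
/-- A regular point (of some codimension `p`) of `Z` is a point at which `Z` is analytic: forget the
surjectivity of the differential of the `p` local equations. [folklore] -/
theorem isAnalyticSetAt_of_isRegularPointOfCodim {H : Type*} [TopologicalSpace H]
    {I : ModelWithCorners ℂ E H} {M : Type*} [TopologicalSpace M] [ChartedSpace H M]
    {Z : Set M} {p : ℕ} {x : M} (h : IsRegularPointOfCodim I Z p x) : IsAnalyticSetAt I Z x := by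
  obtain ⟨U, hU, hxU, g, hg, hZU, -⟩ := h
  exact ⟨U, hU, hxU, p, g, hg, hZU⟩

/-- **The graph of a holomorphic map into a Hausdorff analytic manifold is an analytic subset** of
`M × N`: at its own points it is even regular (`isRegularPointOfCodim_graph`), and it is closed
(`N` Hausdorff: `isClosed_eq`), hence vacuously analytic near every other point
(`IsAnalyticSetAt.of_notMem_closure`). [cite: Chirka1989, §2.3]
[cite: GriffithsHarrisPrinciples1978, Ch. 0 §2] -/
theorem isAnalyticSet_graph [FiniteDimensional ℂ F] [T2Space N] [IsManifold 𝓘(ℂ, F) 1 N]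
    {f : M → N} (hf : MDifferentiable 𝓘(ℂ, E) 𝓘(ℂ, F) f) :
    IsAnalyticSet (𝓘(ℂ, E).prod 𝓘(ℂ, F)) {z : M × N | z.2 = f z.1} := by
  intro z
  by_cases hz : z.2 = f z.1
  · exact isAnalyticSetAt_of_isRegularPointOfCodim (isRegularPointOfCodim_graph hf hz)
  · have hcl : IsClosed {z : M × N | z.2 = f z.1} :=
      isClosed_eq continuous_snd (hf.continuous.comp continuous_fst)
    exact IsAnalyticSetAt.of_notMem_closure (by rwa [hcl.closure_eq])

end Graph

/-- **The graph of a holomorphic map, `.prod` spelling of the model.** Conjunction of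
`isAnalyticSet_graph` and `isRegularPointOfCodim_graph` in the binder layout of the registered stub,
for the product manifold `M × N` charted over `ModelProd E F` (Mathlib's instance `prodChartedSpace`)
with model `𝓘(ℂ, E).prod 𝓘(ℂ, F)`. [cite: Chirka1989, §2.3]
[cite: GriffithsHarrisPrinciples1978, Ch. 0 §2] -/
theorem stub_graphAnalytic_prod :
    ∀ {E : Type} [NormedAddCommGroup E] [NormedSpace ℂ E] [FiniteDimensional ℂ E]
      {F : Type} [NormedAddCommGroup F] [NormedSpace ℂ F] [FiniteDimensional ℂ F]
      {M : Type} [TopologicalSpace M] [ChartedSpace E M]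
      {N : Type} [TopologicalSpace N] [T2Space N] [ChartedSpace F N] [IsManifold 𝓘(ℂ, F) ω N]
      (f : M → N), MDifferentiable 𝓘(ℂ, E) 𝓘(ℂ, F) f →
      IsAnalyticSet (𝓘(ℂ, E).prod 𝓘(ℂ, F)) {z : M × N | z.2 = f z.1} ∧
        ∀ z : M × N, z.2 = f z.1 →
          IsRegularPointOfCodim (𝓘(ℂ, E).prod 𝓘(ℂ, F)) {z : M × N | z.2 = f z.1}
            (Module.finrank ℂ F) z :=
  fun _ hf => ⟨isAnalyticSet_graph hf, fun _ hz => isRegularPointOfCodim_graph hf hz⟩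

/-- **Stub `stub_graphAnalytic` (corrected form).** The graph `{z : M × N | z.2 = f z.1}` of a
complex-differentiable map `f : M → N` from a charted space `M` over `E` to a Hausdorff analytic
manifold `N` over `F` (both models finite-dimensional) is an analytic subset of `M × N`, and each of
its points is a regular point of codimension `finrank ℂ F = dim N` (`isAnalyticSet_graph`,
`isRegularPointOfCodim_graph`). Here `M × N` is charted over `E × F` by Mathlib's `prodChartedSpace`
(an instance only up to unfolding `ModelProd E F = E × F`, whence the `letI`), with model
`𝓘(ℂ, E × F) = 𝓘(ℂ, E).prod 𝓘(ℂ, F)` (`modelWithCornersSelf_prod`). Compared with the registered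
signature: the `letI` line is added (without it `ChartedSpace (E × F) (M × N)` is not found and the
statement does not elaborate) and `[T2Space N]` is added (NECESSARY: for `f = id` the graph is the
diagonal of `N`, and analytic subsets are closed, `IsAnalyticSet.isClosed`, while analytic manifolds
need not be Hausdorff). [cite: Chirka1989, §2.3] [cite: GriffithsHarrisPrinciples1978, Ch. 0 §2] -/
theorem stub_graphAnalytic :
    ∀ {E : Type} [NormedAddCommGroup E] [NormedSpace ℂ E] [FiniteDimensional ℂ E]
      {F : Type} [NormedAddCommGroup F] [NormedSpace ℂ F] [FiniteDimensional ℂ F]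
      {M : Type} [TopologicalSpace M] [ChartedSpace E M]
      {N : Type} [TopologicalSpace N] [T2Space N] [ChartedSpace F N] [IsManifold 𝓘(ℂ, F) ω N]
      (f : M → N), MDifferentiable 𝓘(ℂ, E) 𝓘(ℂ, F) f →
      letI : ChartedSpace (E × F) (M × N) := prodChartedSpace E M F N
      IsAnalyticSet 𝓘(ℂ, E × F) {z : M × N | z.2 = f z.1} ∧
        ∀ z : M × N, z.2 = f z.1 →
          IsRegularPointOfCodim 𝓘(ℂ, E × F) {z : M × N | z.2 = f z.1} (Module.finrank ℂ F) z := by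
  intro E _ _ _ F _ _ _ M _ _ N _ _ _ _ f hf
  rw [modelWithCornersSelf_prod]
  exact stub_graphAnalytic_prod f hf

end Summit.HodgeConjecture.HodgeConjecture.Cruxes.OrthogonalEnveloped.HeckeGraphChow

end
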